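import Mathlib
import HarnessLib
import Summits.HubbardSuperconductivity.HubbardSuperconductivity.Theorems.KLProgrammeKLRegimeWickScaleFlow
import Summits.HubbardSuperconductivity.HubbardSuperconductivity.Theorems.KLProgrammeSalmhoferCutoffDerivBound

/-!
# Route `KLProgramme` — crux K3, ENGINE child gen 5 (stmt-HubbardSuperconductivity-19918 `KLRegimeEngineV14`), stub `stub_engine_step_values`,
# conjunct (E2-v9) at `1 ≤ n`: the LINES of the within-slice Wick flow are diagonal — `klws_contr_derivHardCov_eq_diagContr`

Cell gate-hubbard-kl, seat hubbard-kl-k3c1-p1 (g6), technique «composed-map remainder propagation».  The source of the scale flow of the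
Wick-smeared action (`…WickScaleFlow`, p504230: `∂_Λ kernel_m(𝒲_Λ) = −½·Σ_{X,Y} Ċ_Λ(X,Y)·kernel_m((∂_X𝒲_Λ) ⋆_{D_Λ} (∂_Y𝒲_Λ))`) is a sum of
two-vertex terms whose lines are the SCALE DERIVATIVE `Ċ_Λ = ∂_Λ C^K_{>Λ}` of the hard covariance (exactly one) and the soft covariance
`D_Λ = C^K_{≤Λ}` (any number).  p1 g9's channel reading (`…WickBubbleColourings*`, `…WickBubbleChannelPP/PH`, `vertexFn_dblFold_bubble_pairLabels`) is
stated for an ARBITRARY ordered pair of DIAGONAL lines `contr ℂ Cᵢ = diagContr ℓᵢ`.  This file supplies the two line tables at real cutoff: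

* §1 the derivative of Salmhofer's weight in the scale: `klws_hasDerivAt_cutoffWeight_scale`
  (`∂_Λ χ₂((ω²+e_K²)/Λ²) = χ₂′((ω²+e_K²)/Λ²)·(−2(ω²+e_K²)/Λ³)`), its SIZE `klws_abs_deriv_cutoffWeight_scale_le` (`≤ (64/3)/|Λ|`, from
  `|χ₂′| ≤ 32/3`, `klcd_abs_deriv_salmhoferCutoff_le_sharp`, and `χ₂′ = 0` above `1`, `deriv_salmhoferCutoff_eq_zero_of_gt`) and its SUPPORT `klws_deriv_cutoffWeight_scale_eq_zero`
  (zero unless `Λ²/4 ≤ ω² + e_K² ≤ Λ²`: a shell of scale `Λ`);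
* §2 the derivative line: `klws_deriv_hardCov_scale_eq` (`Ċ_Λ(X,Y) = ½(ẇ_Λ(k_X) + ẇ_Λ(k_Y))·C^K(X,Y)`) and
  **`klws_contr_derivHardCov_eq_diagContr`**: `contr ℂ Ċ_Λ = diagContr (p ↦ ẇ_Λ(p)·βL²·ĝ_K(p))`;
* §3 the hard and soft lines at real cutoff: `klws_contr_covAboveCT_eq_diagContr` (`w_Λ·βL²·ĝ_K`), **`klws_contr_covBelowCT_eq_diagContr`**
  (`(1 − w_Λ)·βL²·ĝ_K`) — the real-`Λ` twins of p1's grid tables `contr_klHardCov/klSoftCov_eq_diagContr` (p499749).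

So on the continuous route the line pair `(Ċ_Λ, D_Λ)` enters p1's identities with `ℓ₁ = ẇ_Λ·βL²ĝ_K` (a shell of scale `Λ`, mass `≍ 1/Λ` per unit
`Λ`, i.e. `≍ 1` per slice `dΛ/Λ`) and `ℓ₂ = (1 − w_Λ)·βL²ĝ_K`.  Exact calculus; nothing about superconductivity is asserted.  0 kit.
-/

noncomputable section

namespace Summit.HubbardSuperconductivity.HubbardSuperconductivity.Theorems.KLRegimeWick

set_option linter.dupNamespace false -- summit = problem name (single-conjunct summit), D-0017

open Finset Literature.MathematicalPhysics.QuantumLattice GrassmannAlgebra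
open Literature.Probability.LatticeModels
open Summit.HubbardSuperconductivity.HubbardSuperconductivity.Theorems.TwoPointAssembly
open Summit.HubbardSuperconductivity.HubbardSuperconductivity.Theorems.KLProgrammeLegKernels
open Summit.HubbardSuperconductivity.HubbardSuperconductivity.Theorems.KLRegimeSplit
open scoped Topology

section Model

variable (L M : ℕ) [NeZero L] (β U μ : ℝ) (K : TrigPolyC4v)

/-! ## §1 The scale derivative of Salmhofer's weight -/

omit [NeZero L] in
/-- **`∂_Λ χ₂((ω²+e_K²)/Λ²) = χ₂′((ω²+e_K²)/Λ²)·(−2(ω²+e_K²)/Λ³)`** (`Λ ≠ 0`). -/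
theorem klws_hasDerivAt_cutoffWeight_scale {Λ : ℝ} (hΛ : Λ ≠ 0) (k : FreqMomentum L M) :
    HasDerivAt (fun Λ' : ℝ => hubbardCutoffWeightCT L M β μ K Λ' k)
      (deriv salmhoferCutoff ((matsubaraFreq β M k.1 ^ 2 + nambuXiCT L μ K k.2 ^ 2) / Λ ^ 2) *
        (-(2 * (matsubaraFreq β M k.1 ^ 2 + nambuXiCT L μ K k.2 ^ 2)) / Λ ^ 3)) Λ := by
  set E : ℝ := matsubaraFreq β M k.1 ^ 2 + nambuXiCT L μ K k.2 ^ 2 with hE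
  have hinner : HasDerivAt (fun Λ' : ℝ => E / Λ' ^ 2) (-(2 * E) / Λ ^ 3) Λ := by
    have h := ((hasDerivAt_pow 2 Λ).inv (pow_ne_zero 2 hΛ)).const_mul E
    refine (h.congr_of_eventuallyEq (Filter.Eventually.of_forall fun Λ' => by simp [div_eq_mul_inv])).congr_deriv ?_
    field_simp
    ring
  have houter : HasDerivAt salmhoferCutoff (deriv salmhoferCutoff (E / Λ ^ 2)) (E / Λ ^ 2) :=
    (((contDiff_salmhoferCutoff (n := 1)).differentiable one_ne_zero).differentiableAt).hasDerivAt
  have h := houter.comp Λ hinner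
  simpa only [hubbardCutoffWeightCT, Function.comp_def, hE] using h

omit [NeZero L] in
/-- The derivative as a `deriv`. -/
theorem klws_deriv_cutoffWeight_scale_eq {Λ : ℝ} (hΛ : Λ ≠ 0) (k : FreqMomentum L M) :
    deriv (fun Λ' : ℝ => hubbardCutoffWeightCT L M β μ K Λ' k) Λ =
      deriv salmhoferCutoff ((matsubaraFreq β M k.1 ^ 2 + nambuXiCT L μ K k.2 ^ 2) / Λ ^ 2) *
        (-(2 * (matsubaraFreq β M k.1 ^ 2 + nambuXiCT L μ K k.2 ^ 2)) / Λ ^ 3) :=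
  (klws_hasDerivAt_cutoffWeight_scale L M β μ K hΛ k).deriv

omit [NeZero L] in
/-- **Size of the derivative weight**: `|∂_Λ w_Λ(k)| ≤ (64/3)/|Λ|` (`|χ₂′| ≤ 32/3`, the argument `x = (ω²+e²)/Λ² ≤ 1` where `χ₂′ ≠ 0`). -/
theorem klws_abs_deriv_cutoffWeight_scale_le {Λ : ℝ} (hΛ : Λ ≠ 0) (k : FreqMomentum L M) :
    |deriv (fun Λ' : ℝ => hubbardCutoffWeightCT L M β μ K Λ' k) Λ| ≤ 64 / 3 / |Λ| := by
  rw [klws_deriv_cutoffWeight_scale_eq L M β μ K hΛ k]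
  set E : ℝ := matsubaraFreq β M k.1 ^ 2 + nambuXiCT L μ K k.2 ^ 2 with hE
  have hE0 : 0 ≤ E := by positivity
  have hΛ2 : 0 < Λ ^ 2 := by positivity
  have hΛa : 0 < |Λ| := abs_pos.2 hΛ
  have hx0 : 0 ≤ E / Λ ^ 2 := div_nonneg hE0 hΛ2.le
  -- the second factor is `-2x/Λ` with `x = E/Λ²`
  have hfac : -(2 * E) / Λ ^ 3 = -(2 * (E / Λ ^ 2)) / Λ := by
    field_simp
  rw [hfac, abs_mul, abs_div, abs_neg, abs_of_nonneg (by positivity : (0 : ℝ) ≤ 2 * (E / Λ ^ 2))]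
  by_cases hx1 : E / Λ ^ 2 ≤ 1
  · have hχ : |deriv salmhoferCutoff (E / Λ ^ 2)| ≤ 32 / 3 := klcd_abs_deriv_salmhoferCutoff_le_sharp _
    calc |deriv salmhoferCutoff (E / Λ ^ 2)| * (2 * (E / Λ ^ 2) / |Λ|)
        ≤ 32 / 3 * (2 * 1 / |Λ|) := by
          refine mul_le_mul hχ ?_ (by positivity) (by norm_num)
          exact div_le_div_of_nonneg_right (by linarith) hΛa.le
      _ = 64 / 3 / |Λ| := by ring
  · rw [deriv_salmhoferCutoff_eq_zero_of_gt (lt_of_not_ge hx1), abs_zero, zero_mul]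
    positivity

omit [NeZero L] in
/-- **Support of the derivative weight**: a shell of scale `Λ` — `∂_Λ w_Λ(k) = 0` unless `Λ²/4 ≤ ω² + e_K(k)² ≤ Λ²`. -/
theorem klws_deriv_cutoffWeight_scale_eq_zero {Λ : ℝ} (hΛ : Λ ≠ 0) (k : FreqMomentum L M)
    (h : matsubaraFreq β M k.1 ^ 2 + nambuXiCT L μ K k.2 ^ 2 < Λ ^ 2 / 4 ∨
      Λ ^ 2 < matsubaraFreq β M k.1 ^ 2 + nambuXiCT L μ K k.2 ^ 2) :
    deriv (fun Λ' : ℝ => hubbardCutoffWeightCT L M β μ K Λ' k) Λ = 0 := by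
  rw [klws_deriv_cutoffWeight_scale_eq L M β μ K hΛ k]
  have hΛ2 : 0 < Λ ^ 2 := by positivity
  rcases h with h | h
  · rw [deriv_salmhoferCutoff_eq_zero_of_lt, zero_mul]
    rw [div_lt_iff₀ hΛ2]
    linarith
  · rw [deriv_salmhoferCutoff_eq_zero_of_gt, zero_mul]
    rw [lt_div_iff₀ hΛ2]
    linarith

/-! ## §2 The derivative line `Ċ_Λ = ∂_Λ C^K_{>Λ}` -/

omit [NeZero L] in
/-- **`Ċ_Λ(X,Y) = ½(ẇ_Λ(k_X) + ẇ_Λ(k_Y))·C^K(X,Y)`** (`Λ ≠ 0`). -/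
theorem klws_deriv_hardCov_scale_eq {Λ : ℝ} (hΛ : Λ ≠ 0) (X Y : HubbardFieldIdx L M) :
    deriv (fun Λ' : ℝ => hubbardCovAboveCT L M β μ 0 K Λ' X Y) Λ =
      (((deriv (fun Λ' : ℝ => hubbardCutoffWeightCT L M β μ K Λ' (momentumOf L M X)) Λ +
          deriv (fun Λ' : ℝ => hubbardCutoffWeightCT L M β μ K Λ' (momentumOf L M Y)) Λ) / 2 : ℝ) : ℂ) *
        hubbardCovarianceCT L M β μ 0 K X Y := by
  have hw := ((klws_hasDerivAt_cutoffWeight_scale L M β μ K hΛ (momentumOf L M X)).add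
    (klws_hasDerivAt_cutoffWeight_scale L M β μ K hΛ (momentumOf L M Y))).div_const 2
  have h := (hw.ofReal_comp).mul_const (hubbardCovarianceCT L M β μ 0 K X Y)
  have h' : HasDerivAt (fun Λ' : ℝ => hubbardCovAboveCT L M β μ 0 K Λ' X Y)
      ((((deriv salmhoferCutoff ((matsubaraFreq β M (momentumOf L M X).1 ^ 2 + nambuXiCT L μ K (momentumOf L M X).2 ^ 2) / Λ ^ 2) *
            (-(2 * (matsubaraFreq β M (momentumOf L M X).1 ^ 2 + nambuXiCT L μ K (momentumOf L M X).2 ^ 2)) / Λ ^ 3) +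
          deriv salmhoferCutoff ((matsubaraFreq β M (momentumOf L M Y).1 ^ 2 + nambuXiCT L μ K (momentumOf L M Y).2 ^ 2) / Λ ^ 2) *
            (-(2 * (matsubaraFreq β M (momentumOf L M Y).1 ^ 2 + nambuXiCT L μ K (momentumOf L M Y).2 ^ 2)) / Λ ^ 3)) / 2 : ℝ) : ℂ) *
        hubbardCovarianceCT L M β μ 0 K X Y) Λ := by
    simpa only [hubbardCovAboveCT, Matrix.of_apply, Pi.add_apply] using h
  rw [h'.deriv, klws_deriv_cutoffWeight_scale_eq L M β μ K hΛ, klws_deriv_cutoffWeight_scale_eq L M β μ K hΛ]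

omit [NeZero L] in
/-- The derivative line as a symmetrically weighted copy of `C^K`. -/
theorem klws_derivHardCov_eq_weighted {Λ : ℝ} (hΛ : Λ ≠ 0) :
    (Matrix.of fun X Y : HubbardFieldIdx L M => deriv (fun Λ' : ℝ => hubbardCovAboveCT L M β μ 0 K Λ' X Y) Λ) =
      Matrix.of fun X Y : HubbardFieldIdx L M =>
        (((deriv (fun Λ' : ℝ => hubbardCutoffWeightCT L M β μ K Λ' (momentumOf L M X)) Λ +
            deriv (fun Λ' : ℝ => hubbardCutoffWeightCT L M β μ K Λ' (momentumOf L M Y)) Λ) / 2 : ℝ) : ℂ) *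
          hubbardCovarianceCT L M β μ 0 K X Y := by
  ext X Y
  simp only [Matrix.of_apply]
  exact klws_deriv_hardCov_scale_eq L M β μ K hΛ X Y

omit [NeZero L] in
/-- `contr Ċ_Λ X Y = ½(ẇ_Λ(k_X) + ẇ_Λ(k_Y))·contr C^K X Y`. -/
theorem klws_contr_derivHardCov {Λ : ℝ} (hΛ : Λ ≠ 0) (X Y : HubbardFieldIdx L M) :
    contr ℂ (Matrix.of fun X Y : HubbardFieldIdx L M => deriv (fun Λ' : ℝ => hubbardCovAboveCT L M β μ 0 K Λ' X Y) Λ) X Y =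
      (((deriv (fun Λ' : ℝ => hubbardCutoffWeightCT L M β μ K Λ' (momentumOf L M X)) Λ +
          deriv (fun Λ' : ℝ => hubbardCutoffWeightCT L M β μ K Λ' (momentumOf L M Y)) Λ) / 2 : ℝ) : ℂ) *
        contr ℂ (hubbardCovarianceCT L M β μ 0 K) X Y := by
  rw [klws_derivHardCov_eq_weighted L M β μ K hΛ]
  exact contr_of_symm_weight _ _ (fun X Y => by rw [add_comm]) X Y

/-- **The derivative line is diagonal**: `contr ℂ Ċ_Λ = diagContr (p ↦ ẇ_Λ(p)·βL²·ĝ_K(p))`, `ẇ_Λ(p) = ∂_Λ χ₂((ω²+e_K²)/Λ²)` — so the pair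
`(Ċ_Λ, D_Λ)` of the continuous route is an admissible line pair of p1's three-channel reading. -/
theorem klws_contr_derivHardCov_eq_diagContr {β : ℝ} (hβ : β ≠ 0) (μ : ℝ) (K : TrigPolyC4v) {Λ : ℝ} (hΛ : Λ ≠ 0) :
    contr ℂ (Matrix.of fun X Y : HubbardFieldIdx L M => deriv (fun Λ' : ℝ => hubbardCovAboveCT L M β μ 0 K Λ' X Y) Λ) =
      diagContr L M (fun p => ((deriv (fun Λ' : ℝ => hubbardCutoffWeightCT L M β μ K Λ' p) Λ : ℝ) : ℂ) *
        (((β * (L : ℝ) ^ 2 : ℝ) : ℂ) * propCT L M β μ K p)) := by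
  refine contr_eq_diagContr (fun p σ Z hZ => ?_) (fun p σ Y hY => ?_) (fun p σ => ?_)
  · rw [klws_contr_derivHardCov L M β μ K hΛ, contr_minus_eq_zero β μ K p σ hZ, mul_zero]
  · rw [klws_contr_derivHardCov L M β μ K hΛ, contr_plus_eq_zero β μ K p σ hY, mul_zero]
  · rw [klws_contr_derivHardCov L M β μ K hΛ, contr_minus_plus hβ]
    simp only [momentumOf]
    rw [show ∀ a : ℝ, (a + a) / 2 = a from fun a => by ring]

omit [NeZero L] in
/-- **Size of the derivative line's values**: `|ẇ_Λ(p)| ≤ (64/3)/|Λ|`, supported on the shell `Λ²/4 ≤ ω² + e_K² ≤ Λ²` (restated for the table). -/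
theorem klws_derivHardCov_lineValue_abs_le {Λ : ℝ} (hΛ : Λ ≠ 0) (p : FreqMomentum L M) :
    ‖((deriv (fun Λ' : ℝ => hubbardCutoffWeightCT L M β μ K Λ' p) Λ : ℝ) : ℂ)‖ ≤ 64 / 3 / |Λ| := by
  rw [Complex.norm_real, Real.norm_eq_abs]
  exact klws_abs_deriv_cutoffWeight_scale_le L M β μ K hΛ p

/-! ## §3 The hard and soft lines at real cutoff -/

/-- **The hard line at real cutoff is diagonal**, value `w_Λ(p)·βL²·ĝ_K(p)` (real-`Λ` twin of `contr_klHardCov_eq_diagContr`). -/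
theorem klws_contr_covAboveCT_eq_diagContr {β : ℝ} (hβ : β ≠ 0) (μ : ℝ) (K : TrigPolyC4v) (Λ : ℝ) :
    contr ℂ (hubbardCovAboveCT L M β μ 0 K Λ) =
      diagContr L M (fun p => (hubbardCutoffWeightCT L M β μ K Λ p : ℂ) * (((β * (L : ℝ) ^ 2 : ℝ) : ℂ) * propCT L M β μ K p)) :=
  contr_eq_diagContr (fun p σ _ hZ => contr_covAboveCT_minus_eq_zero β μ K Λ p σ hZ)
    (fun p σ _ hY => contr_covAboveCT_plus_eq_zero β μ K Λ p σ hY) (fun p σ => contr_covAboveCT_minus_plus hβ μ K Λ p σ)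

/-- **The soft line at real cutoff is diagonal**, value `(1 − w_Λ(p))·βL²·ĝ_K(p)` (real-`Λ` twin of `contr_klSoftCov_eq_diagContr`): the
`D_Λ`-lines of the within-slice source. -/
theorem klws_contr_covBelowCT_eq_diagContr {β : ℝ} (hβ : β ≠ 0) (μ : ℝ) (K : TrigPolyC4v) (Λ : ℝ) :
    contr ℂ (hubbardCovBelowCT L M β μ 0 K Λ) =
      diagContr L M (fun p => ((1 - hubbardCutoffWeightCT L M β μ K Λ p : ℝ) : ℂ) * (((β * (L : ℝ) ^ 2 : ℝ) : ℂ) * propCT L M β μ K p)) := by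
  refine contr_eq_diagContr (fun p σ Z hZ => ?_) (fun p σ Y hY => ?_) (fun p σ => ?_)
  · rw [hubbardCovBelowCT, contr_sub, contr_minus_eq_zero β μ K p σ hZ, contr_covAboveCT_minus_eq_zero β μ K Λ p σ hZ, sub_zero]
  · rw [hubbardCovBelowCT, contr_sub, contr_plus_eq_zero β μ K p σ hY, contr_covAboveCT_plus_eq_zero β μ K Λ p σ hY, sub_zero]
  · rw [hubbardCovBelowCT, contr_sub, contr_minus_plus hβ, contr_covAboveCT_minus_plus hβ]
    push_cast
    ring

end Model

end Summit.HubbardSuperconductivity.HubbardSuperconductivity.Theorems.KLRegimeWick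

end
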